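import Mathlib.Algebra.Ring.GeomSum
import Mathlib.Algebra.Order.BigOperators.Group.Finset
import Mathlib.Analysis.SpecialFunctions.Pow.Real
import HarnessLib

/-!
# NE7, ROAD P4 (law-level): NODE Q.old, item (k15) — THE SIZE RECURSION OF THE SOURCE'S DESCENDANTS
# (`DERIVATION-QLa-NE7-P4.md` §4: generation with a submultiplicative scale-separation profile ⇒ the sizes follow
# the profile itself, up to the birth factor `θ` and a harmless `ρ^m`, `ρ = 1 + θDΛ`)

(Cell `pub-balaban`, sub-cell `t4`, binder row NE7 = node U5, co-owner #4 `b2b-balaban-t4-ne7-p4`, gen 4; skeleton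
`HOME/t4/skeletons/NE7-t4-ne7-p4.md` v1.10 §2 NODE Q.old leaf (QL-a); derivation file
`HOME/t4/b2b-balaban-t4-ne7-p4/g4/DERIVATION-QLa-NE7-P4.md` v1 §4 RECURSION LEMMA.)

HONEST FRAMING (T4-DAG PAGE 1).  Rung (B)+1 on ONE FIXED finite four-torus, CONDITIONAL on `BetaPertH` and the nine
spine estimates (0/9 proved); NOT infinite volume, NOT a mass gap, NOT the Clay problem.  NE7 is NOT PRINTED and NOT
proved here.  Pure [folklore] real analysis over abstract sequences, sorry-free; nothing of the audited series is
asserted; NOT summit progress.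

WHAT IS PROVED.  DICTIONARY (none of it enters the statements): `a m` = the total size `S_{k+m}/s_Z` of the pieces
of one component's posterior kick functional born `m` RG steps after the insertion; `θ` = the birth factor of a new
piece (the one-step source-response lemma's `θ₁′ = O(ε₁)`); `ϑ n` = the relative size of the fluctuation-dependent
part of a piece that is `n` scales OLDER than the fluctuation (`ϑ 0 = 1`; `ϑ n = C·min(L^{-n}, M·L^{-γ n})` for
`n ≥ 1`: sup-norm route for the first `log_L M/(γ-1)` scales, curvature route beyond); the recursion
`a (m+1) ≤ θ · Σ_{m' ≤ m} ϑ (m - m') · a m'` is (RS) of the derivation file.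
* `recursion_profile` — if `ϑ` is SUBMULTIPLICATIVE up to `D` (`ϑ n · ϑ n' ≤ D · ϑ (n + n')`) and has BOUNDED
  BACKWARD RATIO `Λ` (`ϑ n ≤ Λ · ϑ (n + 1)`), and `a 0 ≤ 1`, then `a (m + 1) ≤ θ · (1 + θ·D·Λ)^m · ϑ m` for every
  `m` — the descendants' sizes follow the profile `ϑ` itself (direct generation from the original piece dominates;
  chains of re-generation are summed by the factor `ρ^m`, `ρ = 1 + θDΛ`).
* `recursion_profile_of_small` — the same with `ρ ≤ 1 + 1/L` packaged: if `θ·D·Λ ≤ 1/L` then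
  `a (m+1) ≤ θ · (1 + 1/L)^m · ϑ m`.
-/

noncomputable section

open Finset
open scoped BigOperators

namespace Summit.QuantumFields.BalabanUV.T4Continuum.NE7LawLevel

/-- One summand of the recursion, bounded through the induction hypothesis, submultiplicativity and the backward
ratio: for `m' < m`, `ϑ (m - (m'+1)) · a (m'+1) ≤ θ·D·Λ·ϑ m · ρ^{m'}` whenever `a (m'+1) ≤ θ ρ^{m'} ϑ m'`. [folklore] -/
theorem summand_le {θ D Λ ρ : ℝ} {ϑ a : ℕ → ℝ} (hθ : 0 ≤ θ) (hρ : 0 ≤ ρ) (hϑ : ∀ n, 0 ≤ ϑ n)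
    (hsub : ∀ n n', ϑ n * ϑ n' ≤ D * ϑ (n + n')) (hshift : ∀ n, ϑ n ≤ Λ * ϑ (n + 1)) (hD : 0 ≤ D)
    {m m' : ℕ} (hm' : m' < m) (hIH : a (m' + 1) ≤ θ * ρ ^ m' * ϑ m') :
    ϑ (m - (m' + 1)) * a (m' + 1) ≤ θ * D * Λ * ϑ m * ρ ^ m' := by
  have h1 : ϑ (m - (m' + 1)) * a (m' + 1) ≤ ϑ (m - (m' + 1)) * (θ * ρ ^ m' * ϑ m') :=
    mul_le_mul_of_nonneg_left hIH (hϑ _)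
  have hsum : m - (m' + 1) + m' = m - 1 := by omega
  have h2 : ϑ (m - (m' + 1)) * ϑ m' ≤ D * ϑ (m - 1) := by
    have := hsub (m - (m' + 1)) m'
    rwa [hsum] at this
  have h3 : ϑ (m - 1) ≤ Λ * ϑ m := by
    have := hshift (m - 1)
    rwa [show m - 1 + 1 = m by omega] at this
  have hθρ : 0 ≤ θ * ρ ^ m' := mul_nonneg hθ (pow_nonneg hρ _)
  calc ϑ (m - (m' + 1)) * a (m' + 1) ≤ ϑ (m - (m' + 1)) * (θ * ρ ^ m' * ϑ m') := h1
    _ = θ * ρ ^ m' * (ϑ (m - (m' + 1)) * ϑ m') := by ring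
    _ ≤ θ * ρ ^ m' * (D * ϑ (m - 1)) := mul_le_mul_of_nonneg_left h2 hθρ
    _ ≤ θ * ρ ^ m' * (D * (Λ * ϑ m)) :=
        mul_le_mul_of_nonneg_left (mul_le_mul_of_nonneg_left h3 hD) hθρ
    _ = θ * D * Λ * ϑ m * ρ ^ m' := by ring

/-- **RECURSION LEMMA (`DERIVATION-QLa` §4).**  Let `a 0 ≤ 1`, `a ≥ 0`, and
`a (m+1) ≤ θ · Σ_{m' ∈ range (m+1)} ϑ (m - m') · a m'` for all `m`, with `θ ≥ 0`, `ϑ ≥ 0`,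
`ϑ n · ϑ n' ≤ D · ϑ (n + n')` (submultiplicativity, `D ≥ 0`) and `ϑ n ≤ Λ · ϑ (n+1)` (backward ratio, `Λ ≥ 0`)
(`ϑ 0 = 1` and `a ≥ 0` in the application, but neither is needed for the bound).
Then `a (m + 1) ≤ θ · (1 + θ·D·Λ)^m · ϑ m` for every `m`. [folklore] -/
theorem recursion_profile {θ D Λ : ℝ} {ϑ a : ℕ → ℝ} (hθ : 0 ≤ θ) (hD : 0 ≤ D) (hΛ : 0 ≤ Λ)
    (hϑ : ∀ n, 0 ≤ ϑ n) (hsub : ∀ n n', ϑ n * ϑ n' ≤ D * ϑ (n + n'))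
    (hshift : ∀ n, ϑ n ≤ Λ * ϑ (n + 1)) (ha0 : a 0 ≤ 1)
    (hrec : ∀ m, a (m + 1) ≤ θ * ∑ m' ∈ range (m + 1), ϑ (m - m') * a m') :
    ∀ m, a (m + 1) ≤ θ * (1 + θ * D * Λ) ^ m * ϑ m := by
  set ρ := 1 + θ * D * Λ with hρdef
  have hρ1 : 1 ≤ ρ := by
    rw [hρdef]; exact le_add_of_nonneg_right (mul_nonneg (mul_nonneg hθ hD) hΛ)
  have hρ0 : 0 ≤ ρ := zero_le_one.trans hρ1
  -- strong induction on m
  intro m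
  induction m using Nat.strong_induction_on with
  | _ m IH =>
    -- split off the m' = 0 summand
    have hsplit : ∑ m' ∈ range (m + 1), ϑ (m - m') * a m' =
        (∑ m' ∈ range m, ϑ (m - (m' + 1)) * a (m' + 1)) + ϑ (m - 0) * a 0 := sum_range_succ' _ _
    -- bound the shifted sum by θ D Λ ϑ m Σ ρ^{m'}
    have hinner : ∑ m' ∈ range m, ϑ (m - (m' + 1)) * a (m' + 1) ≤
        ∑ m' ∈ range m, θ * D * Λ * ϑ m * ρ ^ m' := by
      refine sum_le_sum fun m' hm' => ?_
      have hm'lt : m' < m := mem_range.mp hm'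
      exact summand_le hθ hρ0 hϑ hsub hshift hD hm'lt (IH m' hm'lt)
    -- the geometric sum: θ D Λ Σ_{m'<m} ρ^{m'} = ρ^m − 1
    have hgeom : ∑ m' ∈ range m, θ * D * Λ * ϑ m * ρ ^ m' = ϑ m * (ρ ^ m - 1) := by
      rw [← mul_sum]
      have hg : (∑ m' ∈ range m, ρ ^ m') * (ρ - 1) = ρ ^ m - 1 := geom_sum_mul ρ m
      have hρm1 : ρ - 1 = θ * D * Λ := by rw [hρdef]; ring
      rw [hρm1] at hg
      calc θ * D * Λ * ϑ m * ∑ m' ∈ range m, ρ ^ m' = ϑ m * ((∑ m' ∈ range m, ρ ^ m') * (θ * D * Λ)) := by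
            ring
        _ = ϑ m * (ρ ^ m - 1) := by rw [hg]
    -- the m' = 0 summand
    have hzero : ϑ (m - 0) * a 0 ≤ ϑ m := by
      rw [Nat.sub_zero]
      calc ϑ m * a 0 ≤ ϑ m * 1 := mul_le_mul_of_nonneg_left ha0 (hϑ m)
        _ = ϑ m := mul_one _
    calc a (m + 1) ≤ θ * ∑ m' ∈ range (m + 1), ϑ (m - m') * a m' := hrec m
      _ = θ * ((∑ m' ∈ range m, ϑ (m - (m' + 1)) * a (m' + 1)) + ϑ (m - 0) * a 0) := by rw [hsplit]
      _ ≤ θ * (ϑ m * (ρ ^ m - 1) + ϑ m) := by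
          refine mul_le_mul_of_nonneg_left ?_ hθ
          exact add_le_add (hinner.trans (le_of_eq hgeom)) hzero
      _ = θ * (1 + θ * D * Λ) ^ m * ϑ m := by rw [hρdef]; ring

/-- **THE PROFILE UNDER THE ADMISSIBLE SMALLNESS** (`DERIVATION-QLa` §4 (PROFILE)): if moreover `θ·D·Λ ≤ 1/L` for some
`L`, then `a (m + 1) ≤ θ · (1 + 1/L)^m · ϑ m` — the descendants' sizes follow `ϑ` up to the birth factor `θ` and
a factor `(1 + 1/L)^m`, which shifts a geometric rate `L^{-γ}` by at most `1/(L log L)` in the exponent. [folklore] -/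
theorem recursion_profile_of_small {θ D Λ L : ℝ} {ϑ a : ℕ → ℝ} (hθ : 0 ≤ θ) (hD : 0 ≤ D) (hΛ : 0 ≤ Λ)
    (hϑ : ∀ n, 0 ≤ ϑ n) (hsub : ∀ n n', ϑ n * ϑ n' ≤ D * ϑ (n + n'))
    (hshift : ∀ n, ϑ n ≤ Λ * ϑ (n + 1)) (ha0 : a 0 ≤ 1)
    (hrec : ∀ m, a (m + 1) ≤ θ * ∑ m' ∈ range (m + 1), ϑ (m - m') * a m')
    (hsmall : θ * D * Λ ≤ 1 / L) (m : ℕ) : a (m + 1) ≤ θ * (1 + 1 / L) ^ m * ϑ m := by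
  have h := recursion_profile hθ hD hΛ hϑ hsub hshift ha0 hrec m
  have hbase : 0 ≤ 1 + θ * D * Λ := by positivity
  have hle : 1 + θ * D * Λ ≤ 1 + 1 / L := by linarith
  have hpow : (1 + θ * D * Λ) ^ m ≤ (1 + 1 / L) ^ m := pow_le_pow_left₀ hbase hle m
  calc a (m + 1) ≤ θ * (1 + θ * D * Λ) ^ m * ϑ m := h
    _ ≤ θ * (1 + 1 / L) ^ m * ϑ m :=
        mul_le_mul_of_nonneg_right (mul_le_mul_of_nonneg_left hpow hθ) (hϑ m)

end Summit.QuantumFields.BalabanUV.T4Continuum.NE7LawLevel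

end
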